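import Mathlib
import Summits.ResolutionOfSingularities.ResolutionOfSingularities.Theorems.EquisingularLiftEquisingularLiftNatJunctionCuspIdeal
import HarnessLib

/-!
# Junction lemma J2, dictionary: `k[u,v,w]/(v² − u³) ≅ k[s², s³, w]` — the kernel of the cusp parametrisation

[OURS · L1 W4.5(b)] Helper for the research stub `stub_elnat_three_nonisolated` (level 0, companion
centres) of the crux `EquisingularLiftNat` (stmt-ResolutionOfSingularities-20038; route
`EquisingularLift`, chain w45b, CRUX-PLAN v3 §1.6 «NO-DAMAGE (J2)»). NOT a statement of any
manuscript; AI-written kernel lemma of the cell `res-hironaka` (weaker than expert review).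

The J2 files (`…NatJunctionCuspIdeal.lean`, `…NatJunctionCusp.lean`, p499976/p500385) model the
cuspidal cylinder `H = {v² = u³} × 𝔸¹_w` by the IMAGE RING `k[s², s³, w] = φ.range ⊆ k[s, w]` of the
parametrisation `φ : k[u,v,w] → k[s,w]`, `(u,v,w) ↦ (s², s³, w)`, and prove `Bl_X H ≅ 𝔸²_{s,w}`
there. This file closes the dictionary between the two descriptions of `H`:

* `ker_cuspParam` — **`ker φ = (v² − u³)`** (every characteristic, including `2` and `3`), hence
* `nonempty_quotient_cusp_algEquiv_range` — `k[u,v,w]/(v² − u³) ≃ₐ[k] k[s², s³, w]`: the abstract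
  hypersurface `V(v² − u³) ⊂ 𝔸³` IS the scheme `Spec φ.range` of the J2 files.

Method (parity of exponents, no Gröbner bases, valid over any commutative ring for the division
step): every `F ∈ R[u,v,w]` is `(v² − u³)·Q + A(u,w) + v·B(u,w)` (`exists_cusp_division`, by
`MvPolynomial.induction_on`); under `φ` this becomes `A(s²,w) + s³·B(s²,w)`, whose monomials have EVEN
resp. ODD `s`-exponent (`coeff_evenSubst_eq_zero_of_odd`), and the substitution `a ↦ s², b ↦ w` is
injective on monomials (`coeff_evenSubst_theta`); so `φ F = 0` forces `A = B = 0`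
(`eq_zero_of_evenSubst_add_eq_zero`).

References: folklore commutative algebra (the cusp `k[t², t³] ≅ k[u,v]/(v² − u³)`, e.g.
R. Hartshorne, *Algebraic Geometry*, Ex. I.1.2-type computation); cell-internal CRUX-PLAN v3 §1.6.
-/

-- single-problem summit: the doubled namespace component `ResolutionOfSingularities` is forced
set_option linter.dupNamespace false

noncomputable section

open MvPolynomial

namespace Summit.ResolutionOfSingularities.ResolutionOfSingularities.Theorems.EquisingularLift.Junction

universe u

/-! ## Division by `v² − u³` with remainder `A(u,w) + v·B(u,w)` -/

section Division

variable {R : Type u} [CommRing R]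

/-- **Division by `v² − u³`.** Every `F ∈ R[u,v,w]` (variables `X 0, X 1, X 2 = u, v, w`) can be
written `F = (v² − u³)·Q + A(u,w) + v·B(u,w)` with `A, B` polynomials in `u, w` only — here spelt as
`rename ![0, 2]` of polynomials in two variables. (Induction on `F`: multiplying a decomposition by
`v` uses `v·(A + vB) = (v² − u³)·B + u³B + v·A`.) [folklore] -/
theorem exists_cusp_division (F : MvPolynomial (Fin 3) R) :
    ∃ Q : MvPolynomial (Fin 3) R, ∃ A B : MvPolynomial (Fin 2) R,
      F = (X 1 ^ 2 - X 0 ^ 3) * Q + rename ![0, 2] A + X 1 * rename ![0, 2] B := by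
  induction F using MvPolynomial.induction_on with
  | C a => exact ⟨0, C a, 0, by simp⟩
  | add p q hp hq =>
    obtain ⟨Q₁, A₁, B₁, rfl⟩ := hp
    obtain ⟨Q₂, A₂, B₂, rfl⟩ := hq
    exact ⟨Q₁ + Q₂, A₁ + A₂, B₁ + B₂, by simp only [map_add]; ring⟩
  | mul_X p n hp =>
    obtain ⟨Q, A, B, rfl⟩ := hp
    -- the images of the two retained variables
    have hX0 : rename ![(0 : Fin 3), 2] (X 0 : MvPolynomial (Fin 2) R) = X 0 := by
      rw [rename_X]; rfl
    have hX2 : rename ![(0 : Fin 3), 2] (X 1 : MvPolynomial (Fin 2) R) = X 2 := by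
      rw [rename_X]; rfl
    match n with
    | 0 =>
      refine ⟨Q * X 0, A * X 0, B * X 0, ?_⟩
      rw [map_mul, map_mul, hX0]
      ring
    | 1 =>
      refine ⟨Q * X 1 + rename ![0, 2] B, X 0 ^ 3 * B, A, ?_⟩
      rw [map_mul, map_pow, hX0]
      ring
    | 2 =>
      refine ⟨Q * X 2, A * X 1, B * X 1, ?_⟩
      rw [map_mul, map_mul, hX2]
      ring

end Division

/-! ## The even substitution `a ↦ s², b ↦ w` on `k[a, b] → k[s, w]` -/

section EvenSubst

variable {R : Type u} [CommRing R]

/-- The even substitution written monomial by monomial: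
`A(s², w) = Σ_d coeff_d(A) · s^(2 d₀) w^(d₁)`. [folklore] -/
theorem evenSubst_eq_sum (A : MvPolynomial (Fin 2) R) :
    aeval ![(X 0 : MvPolynomial (Fin 2) R) ^ 2, X 1] A =
      ∑ d ∈ A.support, monomial (Finsupp.single 0 (2 * d 0) + Finsupp.single 1 (d 1)) (coeff d A) := by
  rw [MvPolynomial.aeval_def, MvPolynomial.eval₂_eq']
  refine Finset.sum_congr rfl fun d _ => ?_
  have hprod : (∏ i : Fin 2, (![(X 0 : MvPolynomial (Fin 2) R) ^ 2, X 1] i) ^ (d i)) =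
      monomial (Finsupp.single 0 (2 * d 0) + Finsupp.single 1 (d 1)) 1 := by
    rw [Fin.prod_univ_two]
    show ((X 0 : MvPolynomial (Fin 2) R) ^ 2) ^ (d 0) * (X 1) ^ (d 1) = _
    rw [← pow_mul, X_pow_eq_monomial, X_pow_eq_monomial, monomial_mul, mul_one]
  rw [hprod, MvPolynomial.algebraMap_eq, C_mul_monomial, mul_one]

/-- The exponent map `θ : (d₀, d₁) ↦ (2d₀, d₁)` evaluated at `0`. [folklore] -/
theorem theta_apply_zero (x y : ℕ) :
    (Finsupp.single (0 : Fin 2) x + Finsupp.single 1 y : Fin 2 →₀ ℕ) 0 = x := by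
  rw [Finsupp.add_apply, Finsupp.single_eq_same, Finsupp.single_eq_of_ne (by decide), add_zero]

/-- The exponent map `θ : (d₀, d₁) ↦ (2d₀, d₁)` evaluated at `1`. [folklore] -/
theorem theta_apply_one (x y : ℕ) :
    (Finsupp.single (0 : Fin 2) x + Finsupp.single 1 y : Fin 2 →₀ ℕ) 1 = y := by
  rw [Finsupp.add_apply, Finsupp.single_eq_of_ne (by decide), Finsupp.single_eq_same, zero_add]

/-- The exponent map `(d₀, d₁) ↦ (2d₀, d₁)` of the even substitution is injective. [folklore] -/
theorem theta_injective {d d' : Fin 2 →₀ ℕ}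
    (h : Finsupp.single (0 : Fin 2) (2 * d 0) + Finsupp.single 1 (d 1) =
      Finsupp.single 0 (2 * d' 0) + Finsupp.single 1 (d' 1)) : d = d' := by
  have h0 := congrArg (fun e : Fin 2 →₀ ℕ => e 0) h
  have h1 := congrArg (fun e : Fin 2 →₀ ℕ => e 1) h
  simp only [theta_apply_zero, theta_apply_one] at h0 h1
  ext i
  match i with
  | 0 => omega
  | 1 => exact h1

/-- **Parity.** `A(s², w)` has no monomial with odd `s`-exponent. [folklore] -/
theorem coeff_evenSubst_eq_zero_of_odd (A : MvPolynomial (Fin 2) R) (m : Fin 2 →₀ ℕ)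
    (hm : ¬ 2 ∣ m 0) : coeff m (aeval ![(X 0 : MvPolynomial (Fin 2) R) ^ 2, X 1] A) = 0 := by
  classical
  rw [evenSubst_eq_sum, coeff_sum]
  refine Finset.sum_eq_zero fun d _ => ?_
  rw [coeff_monomial]
  split_ifs with h
  · exfalso
    have h0 := congrArg (fun e : Fin 2 →₀ ℕ => e 0) h
    simp only [theta_apply_zero] at h0
    exact hm ⟨d 0, h0.symm⟩
  · rfl

/-- **Injectivity on monomials.** The coefficient of `s^(2d₀) w^(d₁)` in `A(s², w)` is the
coefficient of `a^(d₀) b^(d₁)` in `A`. [folklore] -/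
theorem coeff_evenSubst_theta (A : MvPolynomial (Fin 2) R) (d : Fin 2 →₀ ℕ) :
    coeff (Finsupp.single 0 (2 * d 0) + Finsupp.single 1 (d 1))
      (aeval ![(X 0 : MvPolynomial (Fin 2) R) ^ 2, X 1] A) = coeff d A := by
  classical
  rw [evenSubst_eq_sum, coeff_sum]
  by_cases hd : d ∈ A.support
  · rw [Finset.sum_eq_single_of_mem d hd]
    · rw [coeff_monomial]
      split_ifs with h
      · rfl
      · exact absurd rfl h
    · intro d' _ hne
      rw [coeff_monomial]
      split_ifs with h
      · exact absurd (theta_injective h) hne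
      · rfl
  · rw [notMem_support_iff.mp hd]
    refine Finset.sum_eq_zero fun d' hd' => ?_
    rw [coeff_monomial]
    split_ifs with h
    · exact absurd (theta_injective h ▸ hd') hd
    · rfl

/-- The even substitution `a ↦ s², b ↦ w` is injective. [folklore] -/
theorem evenSubst_eq_zero_iff (A : MvPolynomial (Fin 2) R) :
    aeval ![(X 0 : MvPolynomial (Fin 2) R) ^ 2, X 1] A = 0 ↔ A = 0 := by
  refine ⟨fun h => ?_, fun h => by rw [h, map_zero]⟩
  ext d
  rw [← coeff_evenSubst_theta A d, h, coeff_zero, coeff_zero]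

/-- **The parity argument.** If `A(s², w) + s³·B(s², w) = 0` then `A = B = 0`: the two summands
have disjoint supports (even resp. odd `s`-exponents), so both vanish, and the even substitution
is injective. Valid over every commutative ring (no `2 ≠ 0` needed). [folklore] -/
theorem eq_zero_of_evenSubst_add_eq_zero (A B : MvPolynomial (Fin 2) R)
    (h : aeval ![(X 0 : MvPolynomial (Fin 2) R) ^ 2, X 1] A +
      X 0 ^ 3 * aeval ![(X 0 : MvPolynomial (Fin 2) R) ^ 2, X 1] B = 0) :
    A = 0 ∧ B = 0 := by
  classical
  set ψA := aeval ![(X 0 : MvPolynomial (Fin 2) R) ^ 2, X 1] A with hψA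
  set ψB := aeval ![(X 0 : MvPolynomial (Fin 2) R) ^ 2, X 1] B with hψB
  have hX3 : (X 0 : MvPolynomial (Fin 2) R) ^ 3 = monomial (Finsupp.single 0 3) 1 :=
    X_pow_eq_monomial
  -- every coefficient of `ψA` vanishes
  have hA0 : ψA = 0 := by
    ext m
    rw [coeff_zero]
    by_cases hm : 2 ∣ m 0
    · -- even `s`-exponent: the `s³ ψB` summand contributes nothing
      have hm' : coeff m (X 0 ^ 3 * ψB) = 0 := by
        rw [hX3, coeff_monomial_mul']
        split_ifs with hle
        · rw [one_mul]
          apply coeff_evenSubst_eq_zero_of_odd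
          have h3 : 3 ≤ m 0 := by simpa using hle 0
          simp only [Finsupp.coe_tsub, Pi.sub_apply, Finsupp.single_eq_same]
          omega
        · rfl
      have := congrArg (coeff m) h
      rw [coeff_add, hm', add_zero, coeff_zero] at this
      exact this
    · exact coeff_evenSubst_eq_zero_of_odd A m hm
  have hA : A = 0 := (evenSubst_eq_zero_iff A).mp hA0
  -- then `s³ ψB = 0`, and shifting exponents by `3` recovers the coefficients of `B`
  rw [hA0, zero_add] at h
  have hB : B = 0 := by
    ext d
    rw [coeff_zero, ← coeff_evenSubst_theta B d]
    have := congrArg (coeff (Finsupp.single 0 3 +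
      (Finsupp.single 0 (2 * d 0) + Finsupp.single 1 (d 1)))) h
    rw [hX3, coeff_monomial_mul, one_mul, coeff_zero] at this
    exact this
  exact ⟨hA, hB⟩

end EvenSubst

/-! ## The kernel of the cusp parametrisation -/

section CuspKernel

variable {k : Type u} [Field k]

/-- `φ ∘ rename ![0,2]` is the even substitution: `A(u, w) ↦ A(s², w)`. [folklore] -/
theorem cuspParam_rename (φ : MvPolynomial (Fin 3) k →ₐ[k] MvPolynomial (Fin 2) k)
    (hφ : φ = aeval ![X 0 ^ 2, X 0 ^ 3, X 1]) (A : MvPolynomial (Fin 2) k) :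
    φ (rename ![0, 2] A) = aeval ![(X 0 : MvPolynomial (Fin 2) k) ^ 2, X 1] A := by
  subst hφ
  have hcomp : ((![X 0 ^ 2, X 0 ^ 3, X 1] : Fin 3 → MvPolynomial (Fin 2) k) ∘ ![(0 : Fin 3), 2]) =
      ![(X 0 : MvPolynomial (Fin 2) k) ^ 2, X 1] := by
    funext i
    match i with
    | 0 => rfl
    | 1 => rfl
  rw [aeval_rename, hcomp]

/-- **`ker φ = (v² − u³)`** for the cusp parametrisation `φ : (u,v,w) ↦ (s², s³, w)` — in every
characteristic. `⊇`: `cuspParam_eq_zero` (part 1). `⊆`: divide by `v² − u³`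
(`exists_cusp_division`), map down (`cuspParam_rename`: `φ F = A(s²,w) + s³ B(s²,w)`), and apply the
parity argument `eq_zero_of_evenSubst_add_eq_zero`. [folklore] -/
theorem ker_cuspParam (φ : MvPolynomial (Fin 3) k →ₐ[k] MvPolynomial (Fin 2) k)
    (hφ : φ = aeval ![X 0 ^ 2, X 0 ^ 3, X 1]) :
    RingHom.ker φ = Ideal.span {(X 1 ^ 2 - X 0 ^ 3 : MvPolynomial (Fin 3) k)} := by
  apply le_antisymm
  · intro F hF
    rw [RingHom.mem_ker] at hF
    obtain ⟨Q, A, B, rfl⟩ := exists_cusp_division F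
    have hX1 : φ (X 1) = X 0 ^ 3 := (cuspParam_X φ hφ).2.1
    rw [map_add, map_add, map_mul, map_mul, cuspParam_eq_zero φ hφ, zero_mul, zero_add,
      cuspParam_rename φ hφ, cuspParam_rename φ hφ, hX1] at hF
    obtain ⟨rfl, rfl⟩ := eq_zero_of_evenSubst_add_eq_zero A B hF
    simp only [map_zero, add_zero, mul_zero]
    exact Ideal.mul_mem_right _ _ (Ideal.subset_span rfl)
  · rw [Ideal.span_le, Set.singleton_subset_iff]
    exact cuspParam_eq_zero φ hφ

/-- A polynomial `F(u,v,w)` vanishes on the parametrisation `(s², s³, w)` iff `v² − u³` divides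
it. [folklore] -/
theorem cuspParam_eq_zero_iff_dvd (φ : MvPolynomial (Fin 3) k →ₐ[k] MvPolynomial (Fin 2) k)
    (hφ : φ = aeval ![X 0 ^ 2, X 0 ^ 3, X 1]) (F : MvPolynomial (Fin 3) k) :
    φ F = 0 ↔ (X 1 ^ 2 - X 0 ^ 3 : MvPolynomial (Fin 3) k) ∣ F := by
  rw [← RingHom.mem_ker, ker_cuspParam φ hφ, Ideal.mem_span_singleton]

/-- **The dictionary `k[u,v,w]/(v² − u³) ≅ k[s², s³, w]`**: the coordinate ring of the abstract
cuspidal cylinder `V(v² − u³) ⊂ 𝔸³` is the image ring `φ.range` of the J2 files (first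
isomorphism theorem through `ker_cuspParam`). [folklore] -/
theorem nonempty_quotient_cusp_algEquiv_range (φ : MvPolynomial (Fin 3) k →ₐ[k] MvPolynomial (Fin 2) k)
    (hφ : φ = aeval ![X 0 ^ 2, X 0 ^ 3, X 1]) :
    Nonempty ((MvPolynomial (Fin 3) k ⧸ Ideal.span {(X 1 ^ 2 - X 0 ^ 3 : MvPolynomial (Fin 3) k)})
      ≃ₐ[k] φ.range) :=
  ⟨(Ideal.quotientEquivAlgOfEq k (ker_cuspParam φ hφ).symm).trans (Ideal.quotientKerEquivRange φ)⟩

end CuspKernel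

end Summit.ResolutionOfSingularities.ResolutionOfSingularities.Theorems.EquisingularLift.Junction

end
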